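import Summits.AtomisticToContinuum.BoseEinsteinCondensation.Theorems.BECRewardDescentRewardChordBoundHeredityHelpers
import HarnessLib
-- module: Summits.AtomisticToContinuum.BoseEinsteinCondensation.Theorems.BECRewardDescentRewardChordBoundHeredity

/-!
# The heredity transform is an admissible test class (crux `RewardChordBound`, stmt-AtomisticToContinuum-12876,
# stub R2 `stub_teleportPackage`, registered sub-goal `stub_teleportPackage_Heredity`)

Setting: `N` bosons on the torus `(ℝ/ℤ)^{N×3}` (Haar probability measure), a measurable pair profile `v` vanishing
beyond `R₀` (hard cores allowed: `v` may take the value `+∞` inside), maximal form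
`maxForm v L = maxFormKin L + maxFormPot v L`, slot averages `Pᵢη = η - exciteProj N i η`. For a cut profile `θ`
(`Torus.IsCutProfile K θ`: values in `[0, 1]`, `= 0` on `(-∞, 1]`, `= 1` on `[2, ∞)`, `K`-Lipschitz) and `δ > 0`,
the **star cut-off** of particle `i` is `gᵢ(t) = ∏_{j ≠ i} θ((ρᵢⱼ(t) - R₀/L)/δ)` (`ρᵢⱼ = Torus.pairDist i j`): it is
continuous with values in `[0, 1]`, vanishes unless particle `i` is farther than `R₀/L + δ` from every other
particle, is `(NK/δ)`-Lipschitz along every coordinate line, and relabels under the particle permutations,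
`gᵢ(t ∘ (σ × id)) = g_{σ i}(t)`. The **heredity transform** of a non-negative Bose-symmetric `η` of finite maximal
form is the class `Θ = ∑ᵢ [gᵢ · Pᵢη]`; by the helper file it is Bose-symmetric, non-negative and of finite maximal
form (`exists_heredityTransform`), which for the smooth profile `Torus.smoothCutProfile` is the registered sub-goal
`stub_teleportPackage_Heredity` of the lead's stub `stub_teleportPackage` (the test class of the descent step (β)).

References: M. Reed, B. Simon, *Methods of Modern Mathematical Physics IV* (1978), §XIII.12, Thm XIII.44
[ReedSimonIV1978]; E. H. Lieb, R. Seiringer, J. P. Solovej, J. Yngvason, *The Mathematics of the Bose Gas and its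
Condensation* (2005), Ch. 2 [LSSY2005].
-/

noncomputable section

open MeasureTheory Filter Set Complex UnitAddTorus
open scoped ENNReal NNReal Topology InnerProductSpace ComplexConjugate
open Literature.Analysis.FunctionSpaces Literature.Analysis.OperatorTheory Literature.Analysis.InnerProduct

namespace Summit.AtomisticToContinuum.BoseEinsteinCondensation.Cruxes.RewardChordBound.Birth.Heredity

open Literature.MathematicalPhysics.QuantumManyBody.BoseGas
open Summit.AtomisticToContinuum.BoseEinsteinCondensation.Cruxes.RewardChordBound.Birth.SlotAverage

-- The measure on `ℝ/ℤ` is the Haar PROBABILITY measure, as in `PeriodicFormDomain.lean`.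
attribute [local instance] Literature.MathematicalPhysics.QuantumManyBody.BoseGas.formDomain_measureSpace
  Literature.MathematicalPhysics.QuantumManyBody.BoseGas.formDomain_isProbabilityMeasure
  Literature.MathematicalPhysics.QuantumManyBody.BoseGas.formDomain_isProbabilityMeasure_pi

variable {N : ℕ} {L : ℝ} {v : ℝ → ℝ≥0∞}

/-- Local notation for the Hilbert space `L²((ℝ/ℤ)^{3N})`, as in `PeriodicFormDomain.lean`. -/
local notation "L2T " N':max => Lp ℂ 2 (volume : Measure (UnitAddTorus (Fin N' × Fin 3)))

/-- Local notation for the configuration torus `(ℝ/ℤ)^{N×3}`. -/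
local notation "TN " N':max => UnitAddTorus (Fin N' × Fin 3)

/-! ### The star cut-off of a particle -/

section StarCutoff

variable {K : ℝ≥0} {θ : ℝ → ℝ}

/-- `0 ≤ gᵢ`. [folklore] -/
theorem starCutoff_nonneg (hθ : Torus.IsCutProfile K θ) (r δ : ℝ) (i : Fin N) (t : TN N) :
    0 ≤ ∏ j ∈ Finset.univ.erase i, θ ((Torus.pairDist i j t - r) / δ) :=
  Finset.prod_nonneg fun _ _ => hθ.nonneg _

/-- `gᵢ ≤ 1`. [folklore] -/
theorem starCutoff_le_one (hθ : Torus.IsCutProfile K θ) (r δ : ℝ) (i : Fin N) (t : TN N) :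
    ∏ j ∈ Finset.univ.erase i, θ ((Torus.pairDist i j t - r) / δ) ≤ 1 :=
  Finset.prod_le_one (fun _ _ => hθ.nonneg _) fun _ _ => hθ.le_one _

/-- `|gᵢ| ≤ 1`. [folklore] -/
theorem abs_starCutoff_le_one (hθ : Torus.IsCutProfile K θ) (r δ : ℝ) (i : Fin N) (t : TN N) :
    |∏ j ∈ Finset.univ.erase i, θ ((Torus.pairDist i j t - r) / δ)| ≤ 1 := by
  rw [abs_of_nonneg (starCutoff_nonneg hθ r δ i t)]
  exact starCutoff_le_one hθ r δ i t

/-- `gᵢ` is continuous. [folklore] -/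
theorem continuous_starCutoff (hθ : Torus.IsCutProfile K θ) (r δ : ℝ) (i : Fin N) :
    Continuous fun t : TN N => ∏ j ∈ Finset.univ.erase i, θ ((Torus.pairDist i j t - r) / δ) :=
  continuous_finsetProd _ fun j _ => hθ.continuous.comp (((Torus.continuous_pairDist i j).sub continuous_const).div_const δ)

/-- **Where `gᵢ ≠ 0` particle `i` is free**: `gᵢ(t) ≠ 0` forces `ρᵢⱼ(t) > r + δ` for every `j ≠ i` (`0 < δ`; a factor
with `ρᵢⱼ ≤ r + δ` is `θ(u)` with `u ≤ 1`, hence `0`). [folklore] -/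
theorem lt_pairDist_of_starCutoff_ne_zero (hθ : Torus.IsCutProfile K θ) {r δ : ℝ} (hδ : 0 < δ) {i : Fin N} {t : TN N}
    (h : ∏ j ∈ Finset.univ.erase i, θ ((Torus.pairDist i j t - r) / δ) ≠ 0) {j : Fin N} (hji : j ≠ i) :
    r + δ < Torus.pairDist i j t := by
  by_contra hle
  refine h (Finset.prod_eq_zero (Finset.mem_erase.2 ⟨hji, Finset.mem_univ j⟩) (hθ.of_le_one _ ?_))
  rw [div_le_one hδ]
  linarith [not_lt.1 hle]

/-- One factor of `gᵢ` along a coordinate line `𝐞_{(l,k)}`: for `j ≠ i`,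
`|θ((ρᵢⱼ(t + s𝐞_{(l,k)}) - r)/δ) - θ((ρᵢⱼ(t) - r)/δ)| ≤ K|s|/δ` (it moves only if `l ∈ {i, j}`, and then `ρᵢⱼ` is
`1`-Lipschitz along the line: `Torus.abs_profile_pair_add_single_sub_le(')`, `Torus.pairDist_add_single_of_ne`).
[folklore] -/
theorem abs_factor_add_single_sub_le (hθ : Torus.IsCutProfile K θ) {r δ : ℝ} (hδ : 0 < δ) {i j : Fin N} (hji : j ≠ i)
    (l : Fin N) (k : Fin 3) (t : TN N) (s : ℝ) :
    |θ ((Torus.pairDist i j (t + Pi.single (l, k) ((s : ℝ) : UnitAddCircle)) - r) / δ) -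
        θ ((Torus.pairDist i j t - r) / δ)| ≤ K * (|s| / δ) := by
  have hKs : 0 ≤ K * (|s| / δ) := mul_nonneg K.coe_nonneg (div_nonneg (abs_nonneg _) hδ.le)
  by_cases hl : l = i
  · subst hl
    refine (Torus.abs_profile_pair_add_single_sub_le (r := r) hθ hδ hji.symm t k s).trans ?_
    split_ifs
    · exact le_rfl
    · exact hKs
  · by_cases hlj : l = j
    · subst hlj
      refine (Torus.abs_profile_pair_add_single_sub_le' (r := r) hθ hδ hl t k s).trans ?_
      split_ifs
      · exact le_rfl
      · exact hKs
    · rw [Torus.pairDist_add_single_of_ne hl hlj, sub_self, abs_zero]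
      exact hKs

/-- **`gᵢ` is Lipschitz along every coordinate line**, uniformly: for a direction `p` and a real `s`,
`|gᵢ(t + s𝐞_p) - gᵢ(t)| ≤ (N K/δ)|s|` (each of the `N - 1` factors moves by at most `K|s|/δ`,
`abs_factor_add_single_sub_le`, and `|∏ aⱼ - ∏ bⱼ| ≤ ∑ |aⱼ - bⱼ|` for `[0, 1]`-valued factors,
`abs_prod_sub_prod_le_sum`). [folklore] -/
theorem abs_starCutoff_add_single_sub_le (hθ : Torus.IsCutProfile K θ) {r δ : ℝ} (hδ : 0 < δ) (i : Fin N)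
    (p : Fin N × Fin 3) (t : TN N) (s : ℝ) :
    |(∏ j ∈ Finset.univ.erase i, θ ((Torus.pairDist i j (t + Pi.single p ((s : ℝ) : UnitAddCircle)) - r) / δ)) -
        ∏ j ∈ Finset.univ.erase i, θ ((Torus.pairDist i j t - r) / δ)| ≤ N * K / δ * |s| := by
  have hKs : 0 ≤ (K : ℝ) * (|s| / δ) := mul_nonneg K.coe_nonneg (div_nonneg (abs_nonneg _) hδ.le)
  -- each factor moves by at most `K|s|/δ`
  have hfac : ∀ j ∈ Finset.univ.erase i,
      |θ ((Torus.pairDist i j (t + Pi.single p ((s : ℝ) : UnitAddCircle)) - r) / δ) -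
          θ ((Torus.pairDist i j t - r) / δ)| ≤ K * (|s| / δ) := by
    intro j hj
    rcases p with ⟨l, k⟩
    exact abs_factor_add_single_sub_le hθ hδ (Finset.mem_erase.1 hj).1 l k t s
  set t' : TN N := t + Pi.single p ((s : ℝ) : UnitAddCircle) with ht'
  calc |(∏ j ∈ Finset.univ.erase i, θ ((Torus.pairDist i j t' - r) / δ)) -
        ∏ j ∈ Finset.univ.erase i, θ ((Torus.pairDist i j t - r) / δ)|
      ≤ ∑ j ∈ Finset.univ.erase i, |θ ((Torus.pairDist i j t' - r) / δ) - θ ((Torus.pairDist i j t - r) / δ)| :=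
        abs_prod_sub_prod_le_sum _ (fun _ _ => hθ.nonneg _) (fun _ _ => hθ.le_one _) (fun _ _ => hθ.nonneg _)
          (fun _ _ => hθ.le_one _)
    _ ≤ ∑ _j ∈ Finset.univ.erase i, (K : ℝ) * (|s| / δ) := Finset.sum_le_sum hfac
    _ ≤ ∑ _j : Fin N, (K : ℝ) * (|s| / δ) :=
        Finset.sum_le_sum_of_subset_of_nonneg (Finset.erase_subset _ _) fun _ _ _ => hKs
    _ = N * K / δ * |s| := by
        rw [Finset.sum_const, Finset.card_univ, Fintype.card_fin, nsmul_eq_mul]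
        ring

/-- **The star cut-offs relabel under the particle permutations**: `gᵢ(t ∘ (σ × id)) = g_{σ i}(t)`
(`ρᵢⱼ(t ∘ (σ × id)) = ρ_{σi σj}(t)` and the bijection `j ↦ σ j` of `{j ≠ i}` onto `{j ≠ σ i}`). [folklore] -/
theorem starCutoff_comp_perm (θ : ℝ → ℝ) (r δ : ℝ) (σ : Equiv.Perm (Fin N)) (i : Fin N) (t : TN N) :
    ∏ j ∈ Finset.univ.erase i, θ ((Torus.pairDist i j
        (fun q : Fin N × Fin 3 => t (Equiv.prodCongr σ (Equiv.refl (Fin 3)) q)) - r) / δ) =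
      ∏ j ∈ Finset.univ.erase (σ i), θ ((Torus.pairDist (σ i) j t - r) / δ) := by
  have hτt : (fun q : Fin N × Fin 3 => t (Equiv.prodCongr σ (Equiv.refl (Fin 3)) q)) =
      fun q : Fin N × Fin 3 => t (σ q.1, q.2) := by
    funext q
    rcases q with ⟨a, k⟩
    rfl
  rw [hτt]
  simp only [Torus.pairDist_comp_perm]
  exact Finset.prod_equiv σ (fun j => by simp [Finset.mem_erase]) (fun j _ => rfl)

end StarCutoff

/-! ### The heredity transform -/

/-- **The heredity transform is an admissible test class.** Let `0 < L`, `v` measurable with `v = 0` beyond `R₀`,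
`θ` a cut profile, `0 < δ`, and `η ∈ L²((ℝ/ℤ)^{N×3})` Bose-symmetric, non-negative (`|η| = η`), of finite maximal
form. Then there is a class `Θ` — the sum over the particles `i` of the classes of `gᵢ · (η - exciteProj N i η)`,
`gᵢ(t) = ∏_{j ≠ i} θ((ρᵢⱼ(t) - R₀/L)/δ)` — which is Bose-symmetric (`mem_boseSymmetric_of_coeFn_eq_sum`,
`starCutoff_comp_perm`), non-negative (`absLp_eq_of_coeFn_eq_sum`), of finite maximal form (kinetic part: the
Leibniz estimate with the uniform coordinate-Lipschitz bound of `gᵢ` and `maxFormKin (η - exciteProj N i η) ≤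
maxFormKin η`; potential part: `≤ maxFormPot v L η` because `gᵢ ≠ 0` frees particle `i`), and whose representative
is a.e. `∑ᵢ gᵢ(t) · (η - exciteProj N i η)(t)`. [cite: ReedSimonIV1978, Thm XIII.44] -/
theorem exists_heredityTransform (hL : 0 < L) (hv : Measurable v) {R₀ : ℝ} (hv0 : ∀ r, R₀ < r → v r = 0)
    {K : ℝ≥0} {θ : ℝ → ℝ} (hθ : Torus.IsCutProfile K θ) {δ : ℝ} (hδ : 0 < δ) {η : L2T N}
    (hη : η ∈ boseSymmetric N) (habs : absLp η = η) (hfin : maxForm v L η ≠ ⊤) :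
    ∃ Θ : L2T N, Θ ∈ boseSymmetric N ∧ absLp Θ = Θ ∧ maxForm v L Θ ≠ ⊤ ∧
      (Θ : TN N → ℂ) =ᵐ[volume] fun t => ∑ i : Fin N,
        ((∏ j ∈ Finset.univ.erase i, θ ((Torus.pairDist i j t - R₀ / L) / δ) : ℝ) : ℂ) *
          ((η - exciteProj N i η : L2T N) : TN N → ℂ) t := by
  classical
  -- the summands `gᵢ · Pᵢη ∈ L²`
  have hmem : ∀ i : Fin N, MemLp (fun t : TN N =>
      ((∏ j ∈ Finset.univ.erase i, θ ((Torus.pairDist i j t - R₀ / L) / δ) : ℝ) : ℂ) *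
        ((η - exciteProj N i η : L2T N) : TN N → ℂ) t) 2 (volume : Measure (TN N)) := fun i =>
    memLp_ofReal_mul_of_abs_le_one (continuous_starCutoff hθ _ δ i) (abs_starCutoff_le_one hθ _ δ i) _
  -- the representative of the sum of their classes
  have hrep : ((∑ i : Fin N, ((hmem i).toLp _ : L2T N) : L2T N) : TN N → ℂ) =ᵐ[volume] fun t => ∑ i : Fin N,
      ((∏ j ∈ Finset.univ.erase i, θ ((Torus.pairDist i j t - R₀ / L) / δ) : ℝ) : ℂ) *
        ((η - exciteProj N i η : L2T N) : TN N → ℂ) t := by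
    filter_upwards [coeFn_finset_sum Finset.univ (fun i => ((hmem i).toLp _ : L2T N)),
      ae_all_iff.2 fun i : Fin N => (hmem i).coeFn_toLp] with t h1 h2
    rw [h1]
    exact Finset.sum_congr rfl fun i _ => h2 i
  rw [maxForm_def] at hfin
  obtain ⟨hKin, hPot⟩ := ENNReal.add_ne_top.1 hfin
  refine ⟨∑ i : Fin N, ((hmem i).toLp _ : L2T N),
    mem_boseSymmetric_of_coeFn_eq_sum
      (w := fun i t => ∏ j ∈ Finset.univ.erase i, θ ((Torus.pairDist i j t - R₀ / L) / δ))
      (fun σ i t => starCutoff_comp_perm θ _ δ σ i t) hη hrep,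
    absLp_eq_of_coeFn_eq_sum
      (w := fun i t => ∏ j ∈ Finset.univ.erase i, θ ((Torus.pairDist i j t - R₀ / L) / δ))
      (fun i t => starCutoff_nonneg hθ _ δ i t) habs hrep,
    maxForm_sum_ne_top hv _ fun i _ => ?_, hrep⟩
  -- finite maximal form, summand by summand
  rw [maxForm_def]
  refine ENNReal.add_ne_top.2 ⟨?_, ?_⟩
  · exact maxFormKin_ne_top_of_coeFn_eq_mul hL (continuous_starCutoff hθ _ δ i) (abs_starCutoff_le_one hθ _ δ i)
      (fun p t s => abs_starCutoff_add_single_sub_le hθ hδ i p t s)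
      (ne_top_of_le_ne_top hKin (maxFormKin_sub_exciteProj_le L i η)) (hmem i).coeFn_toLp
  · exact ne_top_of_le_ne_top hPot (maxFormPot_le_of_coeFn_eq_mul_sub_exciteProj hL hv hv0
      (abs_starCutoff_le_one hθ _ δ i)
      (fun t ht j hji => (lt_add_of_pos_right _ hδ).trans (lt_pairDist_of_starCutoff_ne_zero hθ hδ ht hji)) η
      (hmem i).coeFn_toLp)

end Summit.AtomisticToContinuum.BoseEinsteinCondensation.Cruxes.RewardChordBound.Birth.Heredity

namespace Summit.AtomisticToContinuum.BoseEinsteinCondensation.Cruxes.RewardChordBound.Birth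

open Summit.AtomisticToContinuum.BoseEinsteinCondensation.Cruxes.RewardChordBound.Birth.Heredity
  Literature.MathematicalPhysics.QuantumManyBody.BoseGas Literature.Analysis.FunctionSpaces

/-- **Registered sub-goal `stub_teleportPackage_Heredity` of stub `stub_teleportPackage` (the heredity transform).**
For `L > 0`, measurable `v` vanishing beyond `R₀ ≥ 0`, `δ > 0`, and a non-negative Bose-symmetric `η` of finite maximal
form, the class `θ = ∑ᵢ gᵢ · (η - exciteProj N i η)` — star cut-offs `gᵢ(t) = ∏_{j ≠ i} smoothCutProfile((ρᵢⱼ(t) - R₀/L)/δ)`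
times the slot averages — is Bose-symmetric, non-negative and of finite maximal form, with the displayed a.e.
representative (`exists_heredityTransform` for the smooth cut profile, `Torus.exists_isCutProfile_smoothCutProfile`; the
`L²` space is written with the explicit Haar product measure, definitionally the package's `L2T N`).
[cite: ReedSimonIV1978, Thm XIII.44] -/
theorem stub_teleportPackage_Heredity :
    ∀ (N : ℕ) (L : ℝ) (v : ℝ → ENNReal) (R₀ δ : ℝ), 0 < L → Measurable v → (∀ r, R₀ < r → v r = 0) → 0 ≤ R₀ → 0 < δ → ∀ η : MeasureTheory.Lp ℂ 2 (MeasureTheory.Measure.pi fun _ : Fin N × Fin 3 => (AddCircle.haarAddCircle : MeasureTheory.Measure UnitAddCircle)), η ∈ Literature.MathematicalPhysics.QuantumManyBody.BoseGas.boseSymmetric N → Literature.MathematicalPhysics.QuantumManyBody.BoseGas.absLp η = η → Literature.MathematicalPhysics.QuantumManyBody.BoseGas.maxForm v L η ≠ ⊤ → ∃ θ : MeasureTheory.Lp ℂ 2 (MeasureTheory.Measure.pi fun _ : Fin N × Fin 3 => (AddCircle.haarAddCircle : MeasureTheory.Measure UnitAddCircle)), θ ∈ Literature.MathematicalPhysics.QuantumManyBody.BoseGas.boseSymmetric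 N ∧ Literature.MathematicalPhysics.QuantumManyBody.BoseGas.absLp θ = θ ∧ Literature.MathematicalPhysics.QuantumManyBody.BoseGas.maxForm v L θ ≠ ⊤ ∧ ∀ᵐ t ∂(MeasureTheory.Measure.pi fun _ : Fin N × Fin 3 => (AddCircle.haarAddCircle : MeasureTheory.Measure UnitAddCircle)), (θ : UnitAddTorus (Fin N × Fin 3) → ℂ) t = ∑ i : Fin N, (((∏ j ∈ Finset.univ.erase i, Literature.Analysis.FunctionSpaces.Torus.smoothCutProfile ((Literature.Analysis.FunctionSpaces.Torus.pairDist i j t - R₀ / L) / δ) : ℝ)) : ℂ) * ((η - Literature.MathematicalPhysics.QuantumManyBody.BoseGas.exciteProj N i η : MeasureTheory.Lp ℂ 2 (MeasureTheory.Measure.pi fun _ : Fin N × Fin 3 => (AddCircle.haarAddCircle : MeasureTheory.Measure UnitAddCircle))) : UnitAddTorus (Fin N × Fin 3) → ℂ) t := by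
  intro N L v R₀ δ hL hv hv0 _ hδ η hη habs hfin
  obtain ⟨K, hK⟩ := Torus.exists_isCutProfile_smoothCutProfile
  exact exists_heredityTransform hL hv hv0 hK hδ hη habs hfin

end Summit.AtomisticToContinuum.BoseEinsteinCondensation.Cruxes.RewardChordBound.Birth

end
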